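import Literature.Probability.LatticeModels.StarComponents
import HarnessLib

/-!
# Pirogov–Sinai theory, I: abstract contours on `ℤ^d`, compatibility, external families

Topic `Literature/Probability/LatticeModels`. The combinatorial-geometric skeleton of the contour
models of Pirogov–Sinai theory in the two-phase setting of Friedli–Velenik 2017, Ch. 7 (thick
contours for the distance `d_∞`), kept abstract so that it can be instantiated by the random-cluster
contours of Laanait–Messager–Miracle-Solé–Ruiz–Shlosman / Grimmett Ch. 7:

* a `ContourSetup`: a type of contours with a finite `★`-connected support `supp γ ⊂ ℤ^d`, a type
  (exterior label) and labels of the interior components; the interior components `ints γ` of a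
  contour are the bounded `★`-components of the complement of its support (`StarComponents`),
  `hull γ = supp γ ∪ int γ`;
* compatibility `d_∞(supp γ, supp γ') > 1` (FV Def. 7.21), "`γ'` lies inside `γ`"
  (`Below γ' γ`: `hull γ' ⊆ A` for an interior component `A` of `γ`), and the **trichotomy**: two
  compatible contours are nested one way or the other or have disjoint hulls (FV §7.3, the remark
  opening the section, and Lemma 7.23);
* contours in a volume (`InVol`: `d_∞(supp γ, Vᶜ) > 1`), compatible families (`CompFam`, the
  families of eq. (7.34)) and external families (`ExtFam`, pairwise hull-disjoint, the families of
  eq. (7.29)–(7.32)); in a volume with `★`-connected complement the hull of a contour in the volume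
  stays in the volume and interior components are strictly smaller volumes (the induction of §7.4).

Everything is proved; no named facts.

## References

* S. Friedli, Y. Velenik, *Statistical Mechanics of Lattice Systems*, CUP 2017, §7.2.6 (contours,
  ext/int, labels, type), §7.3 (Def. 7.21, 7.22, Lemma 7.23, eqs. (7.29)–(7.34)). [FriedliVelenik2017]
* G. Grimmett, *The Random-Cluster Model*, Springer 2006, §7.5 (contours of the random-cluster
  model, after LMMRS 1991). [Grimmett2006]
-/

noncomputable section

open Finset Relation

namespace Literature.Probability.LatticeModels

/-- The two phases of a two-phase Pirogov–Sinai analysis: `ord` (ordered; for the random-cluster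
model: all edges open, wired) and `dis` (disordered: all edges closed, free).
[cite: Grimmett2006, §7.5 (wired and free contours)] -/
inductive Phase
  | ord
  | dis
  deriving DecidableEq

namespace Phase

/-- The other phase. [folklore] -/
def other : Phase → Phase
  | ord => dis
  | dis => ord

/-- `other` is an involution. [folklore] -/
@[simp] theorem other_other (σ : Phase) : σ.other.other = σ := by cases σ <;> rfl

/-- `other σ ≠ σ`. [folklore] -/
theorem other_ne (σ : Phase) : σ.other ≠ σ := by cases σ <;> decide

/-- A phase is `σ` or the other one. [folklore] -/
theorem eq_or_eq_other (σ σ' : Phase) : σ' = σ ∨ σ' = σ.other := by cases σ <;> cases σ' <;> decide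

end Phase

variable {d : ℕ}

/-! ### Abstract contours -/

/-- **An abstract two-phase contour setup on `ℤ^d`** (Friedli–Velenik §7.2.6, Def. 7.18 and
Lemma 7.19, abstracted): a type `Γ` of contours, each with a finite non-empty `★`-connected support,
a type (the label of its exterior) and a label for each interior component (a function on finite
sets, meaningful on the interior components of the support); `withSupp S` enumerates the finitely
many contours with support `S`. [cite: FriedliVelenik2017, §7.2.6, Def. 7.18 and Lemma 7.19] -/
structure ContourSetup (d : ℕ) where
  /-- the contours -/
  Γ : Type
  /-- equality of contours is decidable -/
  [instDecEq : DecidableEq Γ]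
  /-- the support `γ̄` -/
  supp : Γ → Finset (Site d)
  /-- the type (label of the exterior) -/
  type : Γ → Phase
  /-- the label of an interior component -/
  lab : Γ → Finset (Site d) → Phase
  /-- the contours with a given support -/
  withSupp : Finset (Site d) → Finset Γ
  /-- `withSupp S` is exactly the fibre of `supp` over `S` -/
  mem_withSupp : ∀ S γ, γ ∈ withSupp S ↔ supp γ = S
  /-- supports are non-empty -/
  supp_nonempty : ∀ γ, (supp γ).Nonempty
  /-- supports are `★`-connected -/
  supp_starConn : ∀ γ, StarConn (supp γ : Set (Site d))

attribute [instance] ContourSetup.instDecEq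

namespace ContourSetup

variable (S : ContourSetup d)

/-- The interior `int γ` of a contour: the union of the bounded `★`-components of the complement of
its support. [cite: FriedliVelenik2017, §7.2.6 (int γ)] -/
def intr (γ : S.Γ) : Finset (Site d) := starInt (S.supp γ)

/-- The interior components `A₁, …, A_k` of a contour. [cite: FriedliVelenik2017, §7.2.6, eq. (7.22)] -/
def ints (γ : S.Γ) : Finset (Finset (Site d)) := (starInt (S.supp γ)).image (starIntComp (S.supp γ))

/-- The hull `γ̄ ∪ int γ` of a contour (the complement of its exterior). [cite: FriedliVelenik2017, §7.2.6] -/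
def hull (γ : S.Γ) : Finset (Site d) := starHullFinset (S.supp γ)

/-- The size `|γ̄|` of a contour. [cite: FriedliVelenik2017, §7.3 (|γ̄|)] -/
def size (γ : S.Γ) : ℕ := #(S.supp γ)

/-- **Compatibility** of two contours: their supports are at `d_∞`-distance `> 1`.
[cite: FriedliVelenik2017, §7.3, Def. 7.21] -/
def Compat (γ γ' : S.Γ) : Prop := ∀ x ∈ S.supp γ, ∀ y ∈ S.supp γ', 1 < supDist x y

/-- Compatibility is decidable. [folklore] -/
instance (γ γ' : S.Γ) : Decidable (S.Compat γ γ') := by unfold Compat; infer_instance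

/-- `γ'` lies **inside** `γ`: the hull of `γ'` is contained in an interior component of `γ`.
[cite: FriedliVelenik2017, §7.3, Def. 7.22 (γ̄' ⊂ int γ)] -/
def Below (γ' γ : S.Γ) : Prop := ∃ A ∈ S.ints γ, S.hull γ' ⊆ A

/-- `Below` is decidable. [folklore] -/
instance (γ' γ : S.Γ) : Decidable (S.Below γ' γ) := by unfold Below; infer_instance

/-- A contour **lies in the volume** `V`: `d_∞(γ̄, Vᶜ) > 1`, i.e. the `★`-neighbourhood of its support
is inside `V`. [cite: FriedliVelenik2017, §7.3 (families with d_∞(γ̄, Λᶜ) > 1), eq. (7.48)] -/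
def InVol (γ : S.Γ) (V : Finset (Site d)) : Prop := (S.supp γ).biUnion starBall ⊆ V

/-- `InVol` is decidable. [folklore] -/
instance (γ : S.Γ) (V : Finset (Site d)) : Decidable (S.InVol γ V) := by unfold InVol; infer_instance

/-- The contours of type `σ` in the volume `V`. [cite: FriedliVelenik2017, §7.3, eq. (7.34) (𝒞^#)] -/
def contoursIn (σ : Phase) (V : Finset (Site d)) : Finset S.Γ :=
  (V.powerset.biUnion S.withSupp).filter fun γ => S.type γ = σ ∧ S.InVol γ V

/-! ### Basic properties of supports, interiors and hulls -/

variable {S}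

/-- The hull finset is the hull. [folklore] -/
theorem coe_hull (hd : 2 ≤ d) (γ : S.Γ) : (S.hull γ : Set (Site d)) = starHull (S.supp γ) :=
  coe_starHullFinset hd _

/-- The support lies in the hull. [cite: FriedliVelenik2017, §7.2.6] -/
theorem supp_subset_hull (hd : 2 ≤ d) (γ : S.Γ) : S.supp γ ⊆ S.hull γ := fun _ hx =>
  (mem_starHullFinset hd).2 (subset_starHull _ (mem_coe.2 hx))

/-- The interior lies in the hull. [cite: FriedliVelenik2017, §7.2.6] -/
theorem intr_subset_hull (γ : S.Γ) : S.intr γ ⊆ S.hull γ := sdiff_subset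

/-- The hull is the disjoint union of support and interior. [cite: FriedliVelenik2017, §7.2.6] -/
theorem mem_hull_iff (hd : 2 ≤ d) {γ : S.Γ} {x : Site d} : x ∈ S.hull γ ↔ x ∈ S.supp γ ∨ x ∈ S.intr γ := by
  rw [intr, mem_starInt hd, hull, mem_starHullFinset hd, starHull, Set.mem_compl_iff]
  constructor
  · intro h; by_cases hx : x ∈ S.supp γ
    · exact Or.inl hx
    · exact Or.inr ⟨hx, h⟩
  · rintro (h | h)
    · exact fun he => he.1 h
    · exact h.2

/-- Interior points are off the support. [folklore] -/
theorem not_mem_supp_of_mem_intr (hd : 2 ≤ d) {γ : S.Γ} {x : Site d} (hx : x ∈ S.intr γ) : x ∉ S.supp γ :=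
  ((mem_starInt hd).1 hx).1

/-- Membership in `ints`. [cite: FriedliVelenik2017, §7.2.6, eq. (7.22)] -/
theorem mem_ints {γ : S.Γ} {A : Finset (Site d)} :
    A ∈ S.ints γ ↔ ∃ x ∈ starInt (S.supp γ), starIntComp (S.supp γ) x = A := by
  rw [ints, mem_image]

/-- An interior component lies in the interior. [folklore] -/
theorem subset_intr_of_mem_ints {γ : S.Γ} {A : Finset (Site d)} (hA : A ∈ S.ints γ) : A ⊆ S.intr γ := by
  obtain ⟨x, -, rfl⟩ := mem_ints.1 hA
  exact starIntComp_subset _ _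

/-- An interior component misses the support. [folklore] -/
theorem disjoint_supp_of_mem_ints (hd : 2 ≤ d) {γ : S.Γ} {A : Finset (Site d)} (hA : A ∈ S.ints γ) :
    Disjoint A (S.supp γ) :=
  Finset.disjoint_left.2 fun _ hx => not_mem_supp_of_mem_intr hd (subset_intr_of_mem_ints hA hx)

/-- Interior components are non-empty. [folklore] -/
theorem nonempty_of_mem_ints (hd : 2 ≤ d) {γ : S.Γ} {A : Finset (Site d)} (hA : A ∈ S.ints γ) : A.Nonempty := by
  obtain ⟨x, hx, rfl⟩ := mem_ints.1 hA
  exact ⟨x, mem_starIntComp_self hd hx⟩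

/-- The interior is the union of the interior components. [cite: FriedliVelenik2017, §7.2.6] -/
theorem mem_intr_iff_exists_ints (hd : 2 ≤ d) {γ : S.Γ} {x : Site d} : x ∈ S.intr γ ↔ ∃ A ∈ S.ints γ, x ∈ A :=
  ⟨fun hx => ⟨_, mem_ints.2 ⟨x, hx, rfl⟩, mem_starIntComp_self hd hx⟩,
    fun ⟨_, hA, hx⟩ => subset_intr_of_mem_ints hA hx⟩

/-- The component of an interior point is the member of `ints` containing it. [folklore] -/
theorem eq_starIntComp_of_mem (hd : 2 ≤ d) {γ : S.Γ} {A : Finset (Site d)} (hA : A ∈ S.ints γ) {x : Site d}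
    (hx : x ∈ A) : A = starIntComp (S.supp γ) x := by
  obtain ⟨y, hy, rfl⟩ := mem_ints.1 hA
  exact (starIntComp_eq_of_mem hd hy hx).symm

/-- Distinct interior components are disjoint. [cite: FriedliVelenik2017, §7.2.6, eq. (7.22)] -/
theorem disjoint_of_mem_ints (hd : 2 ≤ d) {γ : S.Γ} {A B : Finset (Site d)} (hA : A ∈ S.ints γ) (hB : B ∈ S.ints γ)
    (hAB : A ≠ B) : Disjoint A B :=
  Finset.disjoint_left.2 fun _ hxA hxB => hAB ((eq_starIntComp_of_mem hd hA hxA).trans (eq_starIntComp_of_mem hd hB hxB).symm)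

/-- A `★`-connected set missing the support and meeting an interior component lies in it.
[cite: FriedliVelenik2017, §7.2.6] -/
theorem subset_of_starConn_of_mem_ints (hd : 2 ≤ d) {γ : S.Γ} {A : Finset (Site d)} (hA : A ∈ S.ints γ)
    {C : Set (Site d)} (hC : StarConn C) (hCS : Disjoint C (S.supp γ : Set (Site d))) {x : Site d}
    (hx : x ∈ C) (hxA : x ∈ A) : C ⊆ (A : Set (Site d)) := by
  rw [eq_starIntComp_of_mem hd hA hxA]
  exact subset_starIntComp_of_starConn hd hC hCS hx (subset_intr_of_mem_ints hA hxA)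

/-- A point off the support `★`-adjacent to an interior component belongs to it. [folklore] -/
theorem mem_of_adj_of_mem_ints (hd : 2 ≤ d) {γ : S.Γ} {A : Finset (Site d)} (hA : A ∈ S.ints γ)
    {x y : Site d} (hx : x ∈ A) (hy : y ∉ S.supp γ) (hxy : (zdStar d).Adj x y) : y ∈ A := by
  obtain ⟨z, hz, rfl⟩ := mem_ints.1 hA
  exact mem_starIntComp_of_starRel hd hz hx ⟨hxy, fun h => not_mem_supp_of_mem_intr hd (starIntComp_subset _ _ hx)
    (mem_coe.1 h), fun h => hy (mem_coe.1 h)⟩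

/-- The complement of an interior component is `★`-connected (FV Exercise 7.11). [cite: FriedliVelenik2017, §7.2.6, Exercise 7.11] -/
theorem starConn_compl_of_mem_ints (hd : 2 ≤ d) {γ : S.Γ} {A : Finset (Site d)} (hA : A ∈ S.ints γ) :
    StarConn (A : Set (Site d))ᶜ := by
  obtain ⟨z, hz, rfl⟩ := mem_ints.1 hA
  exact starConn_compl_starIntComp hd (S.supp_starConn γ) hz

/-- Interior components are `★`-connected. [cite: FriedliVelenik2017, §7.2.6] -/
theorem starConn_of_mem_ints (hd : 2 ≤ d) {γ : S.Γ} {A : Finset (Site d)} (hA : A ∈ S.ints γ) :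
    StarConn (A : Set (Site d)) := by
  obtain ⟨z, hz, rfl⟩ := mem_ints.1 hA
  exact starConn_starIntComp hd hz

/-- The exterior `★`-boundary of an interior component lies in the support. [cite: FriedliVelenik2017, §7.2.6] -/
theorem exBoundary_subset_supp_of_mem_ints (hd : 2 ≤ d) {γ : S.Γ} {A : Finset (Site d)} (hA : A ∈ S.ints γ) :
    exBoundary A ⊆ S.supp γ := by
  intro y hy
  obtain ⟨hyA, x, hx, hxy⟩ := mem_exBoundary.1 hy
  by_contra hyS
  exact hyA (mem_of_adj_of_mem_ints hd hA hx hyS hxy)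

/-- There are far points: outside any finite set and exterior to the support. [folklore] -/
theorem exists_mem_starExt_not_mem (hd : 2 ≤ d) (T : Finset (Site d)) (V : Finset (Site d)) :
    ∃ z, z ∈ starExt T ∧ z ∉ V := by
  set R := max (boxRadius T) (boxRadius V)
  have hT : T ⊆ box d R := (subset_box_boxRadius T).trans (box_mono d (le_max_left _ _))
  have hV : V ⊆ box d R := (subset_box_boxRadius V).trans (box_mono d (le_max_right _ _))
  refine ⟨fun _ => (R : ℤ) + 1, farSet_subset_starExt hd hT (corner_mem_farSet (by omega) le_rfl), fun h => ?_⟩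
  exact (mem_farSet_iff_not_mem_box.1 (corner_mem_farSet (d := d) (by omega) (le_refl R))) (hV h)

/-- **If the support of `γ'` lies in an interior component `A` of `γ`, so does its hull**
(the complement of `A` is `★`-connected, misses `supp γ'` and reaches infinity, hence lies in the
exterior of `γ'`). [cite: FriedliVelenik2017, §7.3 (remark before Def. 7.21) and Exercise 7.11] -/
theorem hull_subset_of_supp_subset (hd : 2 ≤ d) {γ γ' : S.Γ} {A : Finset (Site d)} (hA : A ∈ S.ints γ)
    (h : S.supp γ' ⊆ A) : S.hull γ' ⊆ A := by
  obtain ⟨z, hz, hzV⟩ := exists_mem_starExt_not_mem hd (S.supp γ') A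
  have hsub : (A : Set (Site d))ᶜ ⊆ starExt (S.supp γ') :=
    subset_starExt_of_starConn (starConn_compl_of_mem_ints hd hA)
      (Set.disjoint_left.2 fun x hx hx' => hx (h (mem_coe.1 hx'))) (fun h' => hzV (mem_coe.1 h')) hz
  intro x hx
  by_contra hxA
  exact (mem_starHullFinset hd).1 hx (hsub hxA)

/-- Compatible contours have disjoint supports. [cite: FriedliVelenik2017, Def. 7.21] -/
theorem disjoint_supp_of_compat {γ γ' : S.Γ} (h : S.Compat γ γ') : Disjoint (S.supp γ) (S.supp γ') :=
  Finset.disjoint_left.2 fun x hx hx' => by have := h x hx x hx'; simp at this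

/-- Compatibility is symmetric. [cite: FriedliVelenik2017, Def. 7.21] -/
theorem Compat.symm {γ γ' : S.Γ} (h : S.Compat γ γ') : S.Compat γ' γ :=
  fun y hy x hx => by rw [supDist_comm]; exact h x hx y hy

/-- The `★`-neighbourhood of the support of `γ` misses the support of a compatible `γ'`. [cite: FriedliVelenik2017, Def. 7.21] -/
theorem not_mem_supp_of_mem_starBall_of_compat {γ γ' : S.Γ} (h : S.Compat γ γ') {x z : Site d} (hx : x ∈ S.supp γ)
    (hz : z ∈ starBall x) : z ∉ S.supp γ' := fun hz' => by
  have h1 := h x hx z hz'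
  have h2 := mem_starBall.1 hz
  omega

/-- **Trichotomy for compatible contours** (FV §7.3): one lies inside the other, or their hulls are
disjoint. [cite: FriedliVelenik2017, §7.3 (remark opening the section) and Lemma 7.23] -/
theorem trichotomy (hd : 2 ≤ d) {γ γ' : S.Γ} (h : S.Compat γ γ') :
    S.Below γ' γ ∨ S.Below γ γ' ∨ Disjoint (S.hull γ) (S.hull γ') := by
  have hdisj := disjoint_supp_of_compat h
  have hdisj' : Disjoint (S.supp γ' : Set (Site d)) (S.supp γ) := by
    rw [Set.disjoint_iff_inter_eq_empty, ← coe_inter, disjoint_iff_inter_eq_empty.1 hdisj.symm, coe_empty]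
  have hdisj'' : Disjoint (S.supp γ : Set (Site d)) (S.supp γ') := by
    rw [Set.disjoint_iff_inter_eq_empty, ← coe_inter, disjoint_iff_inter_eq_empty.1 hdisj, coe_empty]
  obtain ⟨y, hy⟩ := S.supp_nonempty γ'
  have hyS : y ∉ S.supp γ := fun h' => Finset.disjoint_left.1 hdisj h' hy
  rcases mem_starExt_or_mem_starInt hd hyS with hye | hyi
  swap
  · -- `γ'` inside `γ`
    left
    refine ⟨starIntComp (S.supp γ) y, mem_ints.2 ⟨y, hyi, rfl⟩, hull_subset_of_supp_subset hd (mem_ints.2 ⟨y, hyi, rfl⟩) ?_⟩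
    exact fun x hx => mem_coe.1 (subset_starIntComp_of_starConn hd (S.supp_starConn γ') hdisj' (mem_coe.2 hy) hyi (mem_coe.2 hx))
  · have hsub' : (S.supp γ' : Set (Site d)) ⊆ starExt (S.supp γ) :=
      subset_starExt_of_starConn (S.supp_starConn γ') hdisj' (mem_coe.2 hy) hye
    obtain ⟨x, hx⟩ := S.supp_nonempty γ
    have hxS : x ∉ S.supp γ' := fun h' => Finset.disjoint_left.1 hdisj hx h'
    rcases mem_starExt_or_mem_starInt hd hxS with hxe | hxi
    swap
    · right; left
      refine ⟨starIntComp (S.supp γ') x, mem_ints.2 ⟨x, hxi, rfl⟩, hull_subset_of_supp_subset hd (mem_ints.2 ⟨x, hxi, rfl⟩) ?_⟩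
      exact fun z hz => mem_coe.1 (subset_starIntComp_of_starConn hd (S.supp_starConn γ) hdisj'' (mem_coe.2 hx) hxi (mem_coe.2 hz))
    · have hsub : (S.supp γ : Set (Site d)) ⊆ starExt (S.supp γ') :=
        subset_starExt_of_starConn (S.supp_starConn γ) hdisj'' (mem_coe.2 hx) hxe
      right; right
      rw [Finset.disjoint_left]
      intro z hz hz'
      rcases (mem_hull_iff hd).1 hz' with hz's | hz'i
      · exact (mem_starHullFinset hd).1 hz (hsub' (mem_coe.2 hz's))
      · rcases (mem_hull_iff hd).1 hz with hzs | hzi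
        · exact ((mem_starInt hd).1 hz'i).2 (hsub (mem_coe.2 hzs))
        · -- `z ∈ int γ ∩ int γ'`: the hull of `γ'` would lie in an interior component of `γ`
          obtain ⟨A, hA, hzA⟩ := (mem_intr_iff_exists_ints hd).1 hzi
          have hhull : (S.hull γ' : Set (Site d)) ⊆ A := by
            refine subset_of_starConn_of_mem_ints hd hA (by rw [coe_hull hd]; exact starConn_starHull hd (S.supp_starConn γ'))
              (Set.disjoint_left.2 fun w hw hws => ?_) (mem_coe.2 hz') hzA
            exact (mem_starHullFinset hd).1 (mem_coe.1 hw) (hsub hws)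
          have hyA : y ∈ A := mem_coe.1 (hhull (mem_coe.2 (supp_subset_hull hd γ' hy)))
          exact ((mem_starInt hd).1 (subset_intr_of_mem_ints hA hyA)).2 hye

/-- Nesting excludes the reverse nesting. [folklore] -/
theorem not_below_of_below (hd : 2 ≤ d) {γ γ' : S.Γ} (h : S.Below γ' γ) : ¬ S.Below γ γ' := by
  rintro ⟨A', hA', h'⟩
  obtain ⟨A, hA, hA''⟩ := h
  obtain ⟨x, hx⟩ := S.supp_nonempty γ
  have h1 : x ∈ S.intr γ := subset_intr_of_mem_ints hA (hA'' (intr_subset_hull γ' (subset_intr_of_mem_ints hA'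
    (h' (supp_subset_hull hd γ hx)))))
  exact not_mem_supp_of_mem_intr hd h1 hx

/-- Nesting is irreflexive. [folklore] -/
theorem not_below_self (hd : 2 ≤ d) (γ : S.Γ) : ¬ S.Below γ γ := fun h => not_below_of_below hd h h

/-- Nesting is transitive. [folklore] -/
theorem Below.trans {γ₁ γ₂ γ₃ : S.Γ} (h₁ : S.Below γ₁ γ₂) (h₂ : S.Below γ₂ γ₃) : S.Below γ₁ γ₃ := by
  obtain ⟨A, hA, hA'⟩ := h₁
  obtain ⟨B, hB, hB'⟩ := h₂
  exact ⟨B, hB, hA'.trans ((subset_intr_of_mem_ints hA).trans ((intr_subset_hull γ₂).trans hB'))⟩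

/-- Nested contours do not have disjoint hulls. [folklore] -/
theorem not_disjoint_hull_of_below (hd : 2 ≤ d) {γ γ' : S.Γ} (h : S.Below γ' γ) : ¬ Disjoint (S.hull γ) (S.hull γ') := by
  obtain ⟨A, hA, hA'⟩ := h
  obtain ⟨y, hy⟩ := S.supp_nonempty γ'
  have hy' : y ∈ S.hull γ' := supp_subset_hull hd γ' hy
  exact fun hdis => Finset.disjoint_left.1 hdis (intr_subset_hull γ (subset_intr_of_mem_ints hA (hA' hy'))) hy'

/-- Nesting strictly decreases the hull. [folklore] -/
theorem card_hull_lt_of_below (hd : 2 ≤ d) {γ γ' : S.Γ} (h : S.Below γ' γ) : #(S.hull γ') < #(S.hull γ) := by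
  obtain ⟨A, hA, hA'⟩ := h
  obtain ⟨x, hx⟩ := S.supp_nonempty γ
  refine card_lt_card ⟨hA'.trans ((subset_intr_of_mem_ints hA).trans (intr_subset_hull γ)), fun hsub => ?_⟩
  exact not_mem_supp_of_mem_intr hd (subset_intr_of_mem_ints hA (hA' (hsub (supp_subset_hull hd γ hx)))) hx

/-! ### Contours in a volume -/

/-- A contour in `V` has its support in `V`. [folklore] -/
theorem supp_subset_of_inVol {γ : S.Γ} {V : Finset (Site d)} (h : S.InVol γ V) : S.supp γ ⊆ V :=
  fun x hx => h (mem_biUnion.2 ⟨x, hx, mem_starBall_self x⟩)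

/-- **In a volume with `★`-connected complement, the hull of a contour in the volume stays in the
volume.** [cite: FriedliVelenik2017, §7.3 (Λ c-connected; Λ = Λ^ext ∪ ⋃ (γ̄' ∪ int γ'))] -/
theorem hull_subset_of_inVol (hd : 2 ≤ d) {γ : S.Γ} {V : Finset (Site d)} (hV : StarConn (V : Set (Site d))ᶜ)
    (h : S.InVol γ V) : S.hull γ ⊆ V := by
  obtain ⟨z, hz, hzV⟩ := exists_mem_starExt_not_mem hd (S.supp γ) V
  have hsub : (V : Set (Site d))ᶜ ⊆ starExt (S.supp γ) :=
    subset_starExt_of_starConn hV (Set.disjoint_left.2 fun x hx hx' => hx (mem_coe.2 (supp_subset_of_inVol h (mem_coe.1 hx'))))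
      (fun h' => hzV (mem_coe.1 h')) hz
  intro x hx
  by_contra hxV
  exact (mem_starHullFinset hd).1 hx (hsub fun h' => hxV (mem_coe.1 h'))

/-- Interior components of a contour in `V` are strictly smaller than `V`.
[cite: FriedliVelenik2017, §7.4 (induction on the volume)] -/
theorem card_lt_of_mem_ints_of_inVol (hd : 2 ≤ d) {γ : S.Γ} {V : Finset (Site d)} (hV : StarConn (V : Set (Site d))ᶜ)
    (h : S.InVol γ V) {A : Finset (Site d)} (hA : A ∈ S.ints γ) : #A < #V := by
  obtain ⟨x, hx⟩ := S.supp_nonempty γ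
  refine card_lt_card ⟨(subset_intr_of_mem_ints hA).trans ((intr_subset_hull γ).trans (hull_subset_of_inVol hd hV h)),
    fun hsub => not_mem_supp_of_mem_intr hd (subset_intr_of_mem_ints hA (hsub (supp_subset_of_inVol h hx))) hx⟩

/-- Interior components of a contour in `V` lie in `V`. [folklore] -/
theorem subset_of_mem_ints_of_inVol (hd : 2 ≤ d) {γ : S.Γ} {V : Finset (Site d)} (hV : StarConn (V : Set (Site d))ᶜ)
    (h : S.InVol γ V) {A : Finset (Site d)} (hA : A ∈ S.ints γ) : A ⊆ V :=
  (subset_intr_of_mem_ints hA).trans ((intr_subset_hull γ).trans (hull_subset_of_inVol hd hV h))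

/-- **A contour inside an interior component of a compatible contour lies in that component as a
volume.** [cite: FriedliVelenik2017, §7.3 (remark opening the section: d_∞(γ̄, (int γ')ᶜ) > 1)] -/
theorem inVol_of_hull_subset (hd : 2 ≤ d) {γ δ : S.Γ} (hc : S.Compat δ γ) {A : Finset (Site d)} (hA : A ∈ S.ints γ)
    (h : S.hull δ ⊆ A) : S.InVol δ A := by
  intro z hz
  obtain ⟨x, hx, hzx⟩ := mem_biUnion.1 hz
  have hxA : x ∈ A := h (supp_subset_hull hd δ hx)
  by_cases hzx' : x = z
  · exact hzx' ▸ hxA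
  · exact mem_of_adj_of_mem_ints hd hA hxA (not_mem_supp_of_mem_starBall_of_compat hc hx hzx)
      (adj_iff_mem_starBall.2 ⟨hzx, hzx'⟩)

/-- **A compatible contour not inside `γ` keeps its `★`-neighbourhood off the hull of `γ`.**
[cite: FriedliVelenik2017, §7.3, Lemma 7.23 and the partition Λ = Λ^ext ∪ ⋃ (γ̄' ∪ int γ')] -/
theorem disjoint_nbhd_hull_of_not_below (hd : 2 ≤ d) {γ δ : S.Γ} (hc : S.Compat δ γ) (h : ¬ S.Below δ γ) :
    Disjoint ((S.supp δ).biUnion starBall) (S.hull γ) := by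
  rw [Finset.disjoint_left]
  intro z hz hzh
  obtain ⟨x, hx, hzx⟩ := mem_biUnion.1 hz
  have hzS : z ∉ S.supp γ := not_mem_supp_of_mem_starBall_of_compat hc hx hzx
  have hzi : z ∈ S.intr γ := ((mem_hull_iff hd).1 hzh).resolve_left hzS
  obtain ⟨A, hA, hzA⟩ := (mem_intr_iff_exists_ints hd).1 hzi
  have hxS : x ∉ S.supp γ := not_mem_supp_of_mem_starBall_of_compat hc hx (mem_starBall_self x)
  have hxA : x ∈ A := by
    by_cases hzx' : z = x
    · exact hzx' ▸ hzA
    · exact mem_of_adj_of_mem_ints hd hA hzA hxS (adj_iff_mem_starBall.2 ⟨mem_starBall_comm.1 hzx, hzx'⟩)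
  refine h ⟨A, hA, hull_subset_of_supp_subset hd hA fun w hw => ?_⟩
  have hdisj : Disjoint (S.supp δ : Set (Site d)) (S.supp γ) := by
    rw [Set.disjoint_iff_inter_eq_empty, ← coe_inter, disjoint_iff_inter_eq_empty.1 (disjoint_supp_of_compat hc), coe_empty]
  exact mem_coe.1 (subset_of_starConn_of_mem_ints hd hA (S.supp_starConn δ) hdisj (mem_coe.2 hx) hxA (mem_coe.2 hw))

/-! ### Families of contours -/

/-- Membership in `contoursIn`. [cite: FriedliVelenik2017, §7.3] -/
theorem mem_contoursIn {σ : Phase} {V : Finset (Site d)} {γ : S.Γ} :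
    γ ∈ S.contoursIn σ V ↔ S.type γ = σ ∧ S.InVol γ V := by
  rw [contoursIn, mem_filter, mem_biUnion]
  exact ⟨fun h => h.2, fun h => ⟨⟨S.supp γ, mem_powerset.2 (supp_subset_of_inVol h.2), (S.mem_withSupp _ _).2 rfl⟩, h⟩⟩

variable (S) in
/-- **Compatible families** of contours of type `σ` in `V` (the families of eq. (7.34)).
[cite: FriedliVelenik2017, §7.3, eq. (7.34)] -/
def CompFam (σ : Phase) (V : Finset (Site d)) : Finset (Finset S.Γ) :=
  (S.contoursIn σ V).powerset.filter fun Δ => (Δ : Set S.Γ).Pairwise S.Compat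

variable (S) in
/-- **External families**: compatible families whose members have pairwise disjoint hulls (the
families of external contours of eqs. (7.29)–(7.32)). [cite: FriedliVelenik2017, §7.3, Def. 7.22 and eq. (7.32)] -/
def ExtFam (σ : Phase) (V : Finset (Site d)) : Finset (Finset S.Γ) :=
  (S.CompFam σ V).filter fun Δ => (Δ : Set S.Γ).Pairwise fun γ γ' => Disjoint (S.hull γ) (S.hull γ')

/-- Membership in `CompFam`. [cite: FriedliVelenik2017, eq. (7.34)] -/
theorem mem_compFam {σ : Phase} {V : Finset (Site d)} {Δ : Finset S.Γ} :
    Δ ∈ S.CompFam σ V ↔ (∀ γ ∈ Δ, S.type γ = σ ∧ S.InVol γ V) ∧ (Δ : Set S.Γ).Pairwise S.Compat := by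
  rw [CompFam, mem_filter, mem_powerset]
  exact ⟨fun h => ⟨fun γ hγ => mem_contoursIn.1 (h.1 hγ), h.2⟩, fun h => ⟨fun γ hγ => mem_contoursIn.2 (h.1 γ hγ), h.2⟩⟩

/-- Membership in `ExtFam`. [cite: FriedliVelenik2017, eq. (7.32)] -/
theorem mem_extFam {σ : Phase} {V : Finset (Site d)} {Δ : Finset S.Γ} :
    Δ ∈ S.ExtFam σ V ↔ Δ ∈ S.CompFam σ V ∧ (Δ : Set S.Γ).Pairwise fun γ γ' => Disjoint (S.hull γ) (S.hull γ') := by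
  rw [ExtFam, mem_filter]

/-- The empty family is compatible. [folklore] -/
theorem empty_mem_compFam (σ : Phase) (V : Finset (Site d)) : (∅ : Finset S.Γ) ∈ S.CompFam σ V :=
  mem_compFam.2 ⟨fun _ h => absurd h (notMem_empty _), by simp⟩

/-- The empty family is external. [folklore] -/
theorem empty_mem_extFam (σ : Phase) (V : Finset (Site d)) : (∅ : Finset S.Γ) ∈ S.ExtFam σ V :=
  mem_extFam.2 ⟨empty_mem_compFam σ V, by simp⟩

/-- Subfamilies of compatible families are compatible. [folklore] -/
theorem subset_mem_compFam {σ : Phase} {V : Finset (Site d)} {Δ Δ' : Finset S.Γ} (h : Δ ∈ S.CompFam σ V) (h' : Δ' ⊆ Δ) :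
    Δ' ∈ S.CompFam σ V :=
  mem_compFam.2 ⟨fun γ hγ => (mem_compFam.1 h).1 γ (h' hγ), (mem_compFam.1 h).2.mono (coe_subset.2 h')⟩

/-- Subfamilies of external families are external. [folklore] -/
theorem subset_mem_extFam {σ : Phase} {V : Finset (Site d)} {Δ Δ' : Finset S.Γ} (h : Δ ∈ S.ExtFam σ V) (h' : Δ' ⊆ Δ) :
    Δ' ∈ S.ExtFam σ V :=
  mem_extFam.2 ⟨subset_mem_compFam (mem_extFam.1 h).1 h', (mem_extFam.1 h).2.mono (coe_subset.2 h')⟩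

end ContourSetup

end Literature.Probability.LatticeModels

end
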